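import Summits.QuantumFields.BalabanUV.Beta.FP.CompositeWardLetters

/-!
# `BalabanUV.Beta.FP.CompositeWardLettersDefect` — road «FP» for binder row D1, ROUTE T branch (β) (jets only): **THE COMPOSITE WARD LETTER `b2` UNDER A
# RESTATED COARSE ROW** — the located answer to the OWNER d1-p3 g24's R-FP-62 (iii) («where does `Db₂` feed the coarse system's order-2 generator slot; is
# `−Db₂′` killed or carried?»), generic half.

WHERE `Db₂` GOES (located, p308750's chain): the one-step covariance jet `c2 : Q₁₂W₀ + 2•Q₁₁W₁ + Q₁₀W₂ = [D̄₂|0]` and the coarse Ward jet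
`d2 : Q₂₂D̄₀ + 2•Q₂₁D̄₁ + Q₂₀D̄₂ = 0` meet in EXACTLY ONE place — `CompositeWardLetters.compWard_b2`, producing the composite letter
`b2 : 𝔔₂W₀ + 2•(𝔔₁W₁) + 𝔔₀W₂ = 0` («the composite averaging's 2-jet kills the static generators»), a hypothesis of the SLICE EXCHANGE
`SliceExchangeJets.secondVar_kkt_slice_change_jets_of_range` inside `NestedStepLawOneShotJets.secondVar_oneShot_nestedStepLaw_jets` (the one-shot static slice
`P` ↦ the moving nested comb slice `[τ₂Q₁(u); τ₁]`).  The coarse factor (`NestedStepLawJetsCorner.secondVar_nestedStepLaw_corner`) never sees `D̄₂`.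
By `compWard_c2` (descent, p-landed) the `b2` word ALWAYS equals `[Q₂₂D̄₀ + 2•Q₂₁D̄₁ + Q₂₀D̄₂ | 0]` from `c0 c1 c2` alone; hence:
* `compWard_b2_iff_d2` — given `c0 c1 c2`, **`b2` holds iff `d2` holds with the SAME `D̄₂`** (`fromCols` is injective);
* `compWard_b2_of_d2_sub` — if instead the coarse row holds with a SHIFTED generator jet, `d2′ : Q₂₂D̄₀ + 2•Q₂₁D̄₁ + Q₂₀(D̄₂ − D̄₂′) = 0`, then
  **`𝔔₂W₀ + 2•(𝔔₁W₁) + 𝔔₀W₂ = [Q₂₀D̄₂′ | 0]`** — the shift is CARRIED into the composite Ward letter as a defect, killed iff `Q₂₀D̄₂′ = 0`;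
* `d2_sub_of_compWard_b2_defect` — conversely a `b2` defect `[Q₂₀D̄₂′|0]` is the same thing as the shifted coarse row.
READING FOR THE DOOR (torus half in `PeriodisedSymCoarseWardContactTwoPure`): with T3's `c2` (pure `Db₂ = c_j³(Q₁₀h)²[tip]`) and T4 (`d2`-LHS `= Q₂₀Db₂′`), U21's
named composite constraint 2-jet satisfies `b2` up to `[Q₂₀Db₂′ | 0]` — zero iff D2DET's number vanishes.

HONEST DEPENDENCY (page 1, mandatory): continuum YM on T⁴ ⇐ BetaPertH ∧ nine spine estimates (0/9 proved); BetaPertH ⇐ (D1) ∧ (D4) ∧ CAP+tail;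
G-an2-4 gates asym, D1 and NE2/3/4.  HONEST FRAMING (cell contract, verbatim): «discharging `BetaPertH` makes Bałaban's UV stability UNCONDITIONAL —
a real constructive-QFT result; it is NOT the continuum limit and NOT the Clay problem.»  ABSOLUTE RULE (cell charter, verbatim): «No internally-minted
statement may enter as a cited fact. Every hypothesis is either kernel-proved in this package or a verbatim quotation of a PUBLISHED theorem with page
reference. The manuscript(s) under audit are NOT citable for their own disputed steps — they are the thing under adjudication; programme-internal
(2001/route/tribunal) claims are never citable.»  THIS MODULE is [folklore] finite-matrix algebra (Mathlib only); no `def`, no `def … : Prop`, nothing cited,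
0 sorry; 0∕4 row-D1 binders; NOT (T-ID), NOT SDF, NOT D1, NOT BetaPertH, NOT continuum, NOT Clay.  «not in print; our bookkeeping».
Provenance: D1 formalisation swarm LEAF PROVER 02, unit b2b-balaban-beta-d1-formalise-leaf-02 gen 24, 2026-08-23 (R-FP-62 (iii) LOCATE).  No existing file touched. -/

namespace Summit.QuantumFields.BalabanUV.Beta.FP.CompositeWardLettersDefect

open Matrix
open Summit.QuantumFields.BalabanUV.Beta.FP.CompositeWardLetters (compWard_c2 fromCols_add)

variable {ν μ κ ρ₁ ρ₂ : Type*} [Fintype ν] [Fintype μ]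
variable (Q₁₀ Q₁₁ Q₁₂ : Matrix μ ν ℝ) (Q₂₀ Q₂₁ Q₂₂ : Matrix κ μ ℝ) (W₀ W₁ W₂ : Matrix ν (ρ₂ ⊕ ρ₁) ℝ) (Db₀ Db₁ Db₂ Db₂' : Matrix μ ρ₂ ℝ)
  {𝔔₀ 𝔔₁ 𝔔₂ : Matrix κ ν ℝ}

/-- [folklore] `[A | 0] = 0 ↔ A = 0` (columns `ρ₂ ⊕ ρ₁`). -/
theorem fromCols_zero_eq_zero_iff (A : Matrix κ ρ₂ ℝ) : fromCols A (0 : Matrix κ ρ₁ ℝ) = 0 ↔ A = 0 := by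
  constructor
  · intro h; ext i j
    have := congrFun (congrFun h i) (Sum.inl j)
    simpa only [fromCols_apply_inl, Matrix.zero_apply] using this
  · rintro rfl; exact fromCols_zero

/-- [folklore] **GIVEN THE ONE-STEP COVARIANCE JETS `c0 c1 c2`, THE COMPOSITE WARD LETTER `b2` HOLDS IFF THE COARSE ROW `d2` HOLDS WITH THE SAME `D̄₂`.** -/
theorem compWard_b2_iff_d2 (c0 : Q₁₀ * W₀ = fromCols Db₀ 0) (c1 : Q₁₁ * W₀ + Q₁₀ * W₁ = fromCols Db₁ 0)
    (c2 : Q₁₂ * W₀ + (2 : ℝ) • (Q₁₁ * W₁) + Q₁₀ * W₂ = fromCols Db₂ 0)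
    (h𝔔₀ : Q₂₀ * Q₁₀ = 𝔔₀) (h𝔔₁ : Q₂₁ * Q₁₀ + Q₂₀ * Q₁₁ = 𝔔₁) (h𝔔₂ : Q₂₂ * Q₁₀ + Q₂₁ * Q₁₁ + (Q₂₁ * Q₁₁ + Q₂₀ * Q₁₂) = 𝔔₂) :
    𝔔₂ * W₀ + (2 : ℝ) • (𝔔₁ * W₁) + 𝔔₀ * W₂ = 0 ↔ Q₂₂ * Db₀ + (2 : ℝ) • (Q₂₁ * Db₁) + Q₂₀ * Db₂ = 0 := by
  rw [compWard_c2 Q₁₀ Q₁₁ Q₁₂ Q₂₀ Q₂₁ Q₂₂ W₀ W₁ W₂ Db₀ Db₁ Db₂ c0 c1 c2 h𝔔₀ h𝔔₁ h𝔔₂, fromCols_zero_eq_zero_iff]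

/-- [folklore] **A SHIFTED COARSE GENERATOR JET IS CARRIED INTO `b2` AS A DEFECT**: with `c0 c1 c2` (one-step covariance, `D̄₂` as `c2` forces it) and the coarse
row along the shifted jet, `d2′ : Q₂₂D̄₀ + 2•Q₂₁D̄₁ + Q₂₀(D̄₂ − D̄₂′) = 0`, the composite letter reads `𝔔₂W₀ + 2•(𝔔₁W₁) + 𝔔₀W₂ = [Q₂₀D̄₂′ | 0]`. -/
theorem compWard_b2_of_d2_sub (c0 : Q₁₀ * W₀ = fromCols Db₀ 0) (c1 : Q₁₁ * W₀ + Q₁₀ * W₁ = fromCols Db₁ 0)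
    (c2 : Q₁₂ * W₀ + (2 : ℝ) • (Q₁₁ * W₁) + Q₁₀ * W₂ = fromCols Db₂ 0)
    (d2' : Q₂₂ * Db₀ + (2 : ℝ) • (Q₂₁ * Db₁) + Q₂₀ * (Db₂ - Db₂') = 0)
    (h𝔔₀ : Q₂₀ * Q₁₀ = 𝔔₀) (h𝔔₁ : Q₂₁ * Q₁₀ + Q₂₀ * Q₁₁ = 𝔔₁) (h𝔔₂ : Q₂₂ * Q₁₀ + Q₂₁ * Q₁₁ + (Q₂₁ * Q₁₁ + Q₂₀ * Q₁₂) = 𝔔₂) :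
    𝔔₂ * W₀ + (2 : ℝ) • (𝔔₁ * W₁) + 𝔔₀ * W₂ = fromCols (Q₂₀ * Db₂') 0 := by
  rw [compWard_c2 Q₁₀ Q₁₁ Q₁₂ Q₂₀ Q₂₁ Q₂₂ W₀ W₁ W₂ Db₀ Db₁ Db₂ c0 c1 c2 h𝔔₀ h𝔔₁ h𝔔₂]
  congr 1
  rw [Matrix.mul_sub] at d2'
  rw [← sub_eq_zero, ← d2']
  abel

/-- [folklore] conversely, **a `b2` defect `[Q₂₀D̄₂′ | 0]` IS the shifted coarse row** (given `c0 c1 c2`). -/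
theorem d2_sub_of_compWard_b2_defect (c0 : Q₁₀ * W₀ = fromCols Db₀ 0) (c1 : Q₁₁ * W₀ + Q₁₀ * W₁ = fromCols Db₁ 0)
    (c2 : Q₁₂ * W₀ + (2 : ℝ) • (Q₁₁ * W₁) + Q₁₀ * W₂ = fromCols Db₂ 0)
    (h𝔔₀ : Q₂₀ * Q₁₀ = 𝔔₀) (h𝔔₁ : Q₂₁ * Q₁₀ + Q₂₀ * Q₁₁ = 𝔔₁) (h𝔔₂ : Q₂₂ * Q₁₀ + Q₂₁ * Q₁₁ + (Q₂₁ * Q₁₁ + Q₂₀ * Q₁₂) = 𝔔₂)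
    (b2' : 𝔔₂ * W₀ + (2 : ℝ) • (𝔔₁ * W₁) + 𝔔₀ * W₂ = fromCols (Q₂₀ * Db₂') 0) :
    Q₂₂ * Db₀ + (2 : ℝ) • (Q₂₁ * Db₁) + Q₂₀ * (Db₂ - Db₂') = 0 := by
  rw [compWard_c2 Q₁₀ Q₁₁ Q₁₂ Q₂₀ Q₂₁ Q₂₂ W₀ W₁ W₂ Db₀ Db₁ Db₂ c0 c1 c2 h𝔔₀ h𝔔₁ h𝔔₂] at b2'
  have h : Q₂₂ * Db₀ + (2 : ℝ) • (Q₂₁ * Db₁) + Q₂₀ * Db₂ = Q₂₀ * Db₂' := by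
    have := congrArg (fun X : Matrix κ (ρ₂ ⊕ ρ₁) ℝ => X.toCols₁) b2'
    simpa only [toCols₁_fromCols] using this
  rw [Matrix.mul_sub, ← add_sub_assoc, h, sub_self]

end Summit.QuantumFields.BalabanUV.Beta.FP.CompositeWardLettersDefect
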